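import Summits.BirchSwinnertonDyer.Rank1Residual.F1Sign2.SplitPrimeSpinLaw446AtTwo
import Summits.BirchSwinnertonDyer.Rank1Residual.F1Sign2.GenusTrivialSpinLawAtTwo
import Summits.BirchSwinnertonDyer.Rank1Residual.F1Sign2.GenusTrivialSpinLawWeakAtTwo
import HarnessLib

/-!
# DESC-34/35 kernel — REF1 §208's sorry-free kernel certificates K208.1–12 for `F1Sign2/SplitPrimeSpinLaw446AtTwo.lean` (§34) and `F1Sign2/GenusTrivialSpinLawAtTwo.lean`
# (§35), -desc's 11a1 norm-form sanity check, and the typer's definitional bridges (typer -ty g19; proofs only, no `def`)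

THEOREMS ONLY, sub-namespace `…F1Sign2.SpinLawKernel` (REF1's `K208_*` names kept; the g18/g19 kernel precedent).  Source `HOME/REF1-data/b208/Probe208.lean` **d651f3415836a4c9** Part D
l.412–508 VERBATIM (statements and proofs): K208.1/1′ no labelling of three primes over `2` (`Fin 3 ↛ ZMod 2`) — the `p = 2` instances of every §34/§35 row are vacuous for the
right reason; K208.2/2′ on the diagonal `SpinBitAtSplit p a i i g` / `SpinBitC … i i g` are TRUE (`IsSquare 0`) ⟹ the binder `i ≠ j` is LOAD-BEARING; K208.3 / K208.4a / K208.4b purity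
contains `IsSquare (−1)` (`(−1,1)` is always an integral unit quotient) ⟹ `p % 4 ≠ 3`; K208.5/5′ the cofactor reading `n / p` is exact inside both member predicates; **K208.6** the
KERNEL CERTIFICATE of step 5 «PARITY ⟹ POSITION» of -desc's proof sketch (MEMO-desc §35-add1): over `𝔽₂` a symmetric `2 × 2` matrix `S` such that `S` and `S + J` (`J = [0,1;1,0]`) are
each `0` or invertible lies in `{0, J}` (`decide`) — the step forcing the relaxed image `I ∈ {A⁺, A⁻}` («2 of the 8 Lagrangians»), i.e. the opposite-sign half of DESC-35-WD and
the frame of 34-S/35-S; K208.7 labels pairwise distinct; K208.8/9/10 -desc's two glues and the link re-checked (they are filed in the statement files; here REF1's one-line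
re-derivations); K208.11 WD is reflexive-trivial on the diagonal only; K208.12 `SpinSetting W → OnOddBranchRankOneAtTwo W → False` — the §34 (446a1, `#Sel₂ = 2`) and §35
(`#Sel₂ = 1`) populations are DISJOINT, both files are needed.  Plus: `mulMatrixCubic_det_11a1` (= -desc's Sketch35 `example`: `det M_X = −1` for `c = X³ − X² + X + 1`, so `θ` is a
unit of the cubic field of 11a1 — it is the fundamental unit), and the typer's bridges `isCurve446a1_iff` / `IsCurve446a1.elim` (the a-invariant conjunction vs the landed §33
inline binders — REF1 §208 R208a «one form tree-wide»), `evalModC_eq_evalMod` (`rfl`), `spinBitC_446_iff` (§34's datum inside §35's carrier); v2 APPEND (-ty g19, REF1 §212): K212.1–4 over the sibling `GenusTrivialSpinLawWeakAtTwo.lean` (see the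
last section).  REF1 §208 (A1): farm rc 0,
`#print axioms K208_6` = [propext, Classical.choice, Quot.sound].  Nothing here bears on BSD; 23715 not closed.
v3 (typer -ty g19): + REF1 §214 K214.1–4 (DESC-35-add6 rows: `SpinObstructingPrime` sanity lemmas) appended verbatim at the end.
-/

noncomputable section

open scoped Classical

open WeierstrassCurve Literature.NumberTheory.EllipticCurves Polynomial

namespace Summit.BirchSwinnertonDyer.Rank1Residual.F1Sign2.SpinLawKernel

/-! ## REF1 §208 Part D — BC7 / kernel lemmas (sorry-free; K208.1 … K208.12 VERBATIM) -/

/-- K208.1 (BC7, degenerate `p = 2`): there is NO labelling of three primes over `2` — `Fin 3` does not inject into `ZMod 2`; so every §34 row is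
vacuous at `p = 2` for the right reason (and `p = 2` is excluded anyway by `OneInvolutionOneSplitRestCycles`). -/
theorem K208_1 (a : Fin 3 → ZMod 2) : ¬ LabelledRootsMod 2 a := by
  rintro ⟨ha, -⟩
  have h := Fintype.card_le_of_injective a ha
  simp [ZMod.card] at h

/-- K208.1′ (same for the §35 carrier). -/
theorem K208_1' (c : ℤ[X]) (a : Fin 3 → ZMod 2) : ¬ LabelledRootsModC c 2 a := by
  rintro ⟨ha, -⟩
  have h := Fintype.card_le_of_injective a ha
  simp [ZMod.card] at h

/-- K208.2 (BC7, the `i ≠ j` guard is load-bearing): on the diagonal the spin predicate is `IsSquare 0`, i.e. TRUE — without `i ≠ j` the §34 law would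
force `κ₀(p) = 1` at every pure prime (data: `κ₀ = 0` at `p = 2957`). -/
theorem K208_2 (p : ℕ) (a : Fin 3 → ZMod p) (i : Fin 3) (g : ℤ[X]) : SpinBitAtSplit p a i i g := by
  simp [SpinBitAtSplit]

/-- K208.2′ (same for `SpinBitC`). -/
theorem K208_2' (xnum : ℤ[X]) (xden p : ℕ) (a : Fin 3 → ZMod p) (i : Fin 3) (g : ℤ[X]) : SpinBitC xnum xden p a i i g := by
  simp [SpinBitC]

/-- K208.3 (A2, purity contains `p ≢ 3 (mod 4)`): the first conjunct of `UnitsSquareModPrimesOver` is `IsSquare (-1 : ZMod p)`. -/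
theorem K208_3 (p : ℕ) [Fact p.Prime] (a : Fin 3 → ZMod p) (h : UnitsSquareModPrimesOver p a) : p % 4 ≠ 3 :=
  ZMod.exists_sq_eq_neg_one_iff.mp h.1

/-- K208.4a (A2 for §35 purity): `−1 = (−1)/1` IS an integral unit quotient for every cubic `c` (norm `|det(−1)| = 1 = 1³`, characteristic-polynomial
divisibilities by powers of `k = 1` trivial) — so `IntegralUnitsSquareModC` really contains the unit `−1`, as the docstring says. -/
theorem K208_4a (c : ℤ[X]) : IsIntegralUnitQuot c (-1) 1 := by
  refine ⟨Nat.one_pos, ?_, ?_, ?_⟩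
  · simp
  · intro i _
    simp
  · have hM : mulMatrixCubic c (-1) = -1 := by
      ext i j
      simp [mulMatrixCubic, Matrix.one_apply, Matrix.neg_apply, Polynomial.coeff_one]
    rw [hM, Matrix.det_neg, Matrix.det_one]
    simp

/-- K208.4b: hence §35 purity at `p ∤ 1` (every `p ≠ 1`) gives `IsSquare (-1 : ZMod p)`, i.e. `p ≢ 3 (mod 4)` for prime `p` (docstring claim «with
`g = −1, k = 1` this contains `p ≡ 1 (4)`» ✓ for odd `p`). -/
theorem K208_4b (c : ℤ[X]) (p : ℕ) [hp : Fact p.Prime] (a : Fin 3 → ZMod p) (h : IntegralUnitsSquareModC c p a) : p % 4 ≠ 3 := by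
  have h1 : ¬ p ∣ 1 := by
    intro hd
    exact hp.out.one_lt.ne' (Nat.dvd_one.mp hd)
  have := h (-1) 1 (K208_4a c) h1 0
  apply ZMod.exists_sq_eq_neg_one_iff.mp
  simpa [evalModC] using this

/-- K208.5 (A2, the cofactor reading `n / p` is exact): inside `GenusTrivialTwistMember` the split factor divides `n`, so `(n / p) * p = n`
(no ℕ-division junk in `KappaBitOfMember`). -/
theorem K208_5 (W : WeierstrassCurve ℚ) [W.IsGloballyMinimal] (n p : ℕ) (h : GenusTrivialTwistMember W n p) : n / p * p = n :=
  Nat.div_mul_cancel h.2.2.2.2.1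

/-- K208.5′ (same for the §34 member: `p ∣ n` is the fifth conjunct of `OneInvolutionOneSplitRestCycles`). -/
theorem K208_5' (W : WeierstrassCurve ℚ) [W.IsGloballyMinimal] (n r p : ℕ) (h : Curve446NuZeroSplitMember W n r p) : n / p * p = n :=
  Nat.div_mul_cancel h.2.2.2.1.2.2.2.2.1

/-- K208.6 (KERNEL CERTIFICATE of the finite enumeration in step 5 of -desc's proof sketch, MEMO-desc §35-add1 «PARITY ⟹ POSITION»): over `𝔽₂`,
if a symmetric `2 × 2` matrix `S` and `S + J` (`J = [0,1;1,0]`, the alternating invertible form) BOTH have even-dimensional kernel — i.e. each is `0` or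
invertible (`det = 1`) — then `S ∈ {0, J}`.  (All 8 symmetric matrices enumerated by `decide`; the three invertible symmetric `S ≠ J` have `S + J` singular.)
This is exactly the step forcing the relaxed image `I ∈ {A⁺, A⁻}` («2 of the 8 Lagrangians»). -/
theorem K208_6 : ∀ S : Fin 2 → Fin 2 → ZMod 2, S 0 1 = S 1 0 →
    ((S = 0) ∨ S 0 0 * S 1 1 + S 0 1 * S 1 0 = 1) →
    ((∀ i j, S i j + (if i = j then 0 else 1) = 0) ∨
      (S 0 0 + 0) * (S 1 1 + 0) + (S 0 1 + 1) * (S 1 0 + 1) = 1) →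
    (S = 0 ∨ ∀ i j, S i j = if i = j then 0 else 1) := by
  decide

/-- K208.7 (A2, the labelled roots are roots): `LabelledRootsMod p a` makes each `a j` a root of `cubic446` mod `p` and the three roots distinct, so for
`p` prime `cubic446` is separable mod `p`, whence `p ∤ disc = 892 = 2²·223` — REF1 `alg208.py`: `−Res(c, c′) = 892`; the binder therefore silently
implies `p ∉ {2, 223}` (✓ intended). Kernel part: distinctness of the labels. -/
theorem K208_7 (p : ℕ) (a : Fin 3 → ZMod p) (h : LabelledRootsMod p a) : a 0 ≠ a 1 ∧ a 0 ≠ a 2 ∧ a 1 ≠ a 2 := by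
  refine ⟨fun e => ?_, fun e => ?_, fun e => ?_⟩ <;> have := h.1 e <;> simp at this

/-- K208.8 (glue re-check, -desc's `spinTimesFrobenian_of_modEight` verbatim in the probe namespace): SF8 ⟹ SF. -/
theorem K208_8 (h : Curve446SplitPrimeSpinTimesFrobenianModEight) : Curve446SplitPrimeSpinTimesFrobenian :=
  spinTimesFrobenian_of_modEight h

/-- K208.9 (glue re-check): DESC-34-S + DESC-33-P ⟹ DESC-34-S_an. -/
theorem K208_9 (hS : Curve446SplitPrimePureSpinLaw) (hP : TwistShaAnOddIffSelmerTrivialAtTwo) : Curve446SplitPrimePureSpinShaAnLaw :=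
  curve446PureSpinShaAnLaw_of_spinLaw_of_parity hS hP

/-- K208.10 (link re-check): an odd-power generator with `o = 1` is a generator. -/
theorem K208_10 {c : ℤ[X]} {p : ℕ} {a : ZMod p} {g : ℤ[X]} (h : GeneratesOddPrimePowerOverC c p a g 1) : GeneratesPrimeOverC c p a g :=
  generatesPrimeOverC_of_oddPower_one h

/-- K208.11 (BC7, DESC-35-WD is reflexive-trivial only on the diagonal `n = n'`; content is off-diagonal). -/
theorem K208_11 (W : WeierstrassCurve ℚ) (n p : ℕ) : (KappaBitOfMember W n p ↔ KappaBitOfMember W n p) := Iff.rfl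

/-- K208.12 (A2, `SpinSetting` pins `#Sel₂(W) = 1`, so `W` is NOT on the rank-one odd branch of §34 (`#Sel₂ = 2`): the §34 and §35 populations are disjoint). -/
theorem K208_12 (W : WeierstrassCurve ℚ) [W.IsElliptic] [W.IsGloballyMinimal] (h35 : SpinSetting W) (h34 : OnOddBranchRankOneAtTwo W) : False := by
  have h1 := h35.1
  have h2 := h34.2.2.2.1
  omega

/-! ## -desc's norm-form sanity check (Sketch35 v3.2 `example`) -/

/-- Sanity (kernel): the norm form of the datum is right on an example — `N(θ) = −c₀`: for `11a1`, `det M_X = −1`, so `θ` is a unit (it is the fundamental unit).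
(Typer: -desc's in-file `example` of Sketch35 v3.2 l.223–224, filed as a named kernel theorem; statement and proof VERBATIM.) -/
theorem mulMatrixCubic_det_11a1 : (mulMatrixCubic (X ^ 3 - X ^ 2 + X + 1 : ℤ[X]) X).det = -1 := by
  simp [mulMatrixCubic, companionCubic, Matrix.det_fin_three, coeff_add, coeff_sub, coeff_X_pow, coeff_X, coeff_one]

/-! ## Typer bridges (R208a «one form tree-wide»; «do not silently re-define») -/

/-- `IsCurve446a1 W` IS the conjunction of the five inline binders `W.a₁ = 1 → W.a₂ = 1 → W.a₃ = 0 → W.a₄ = -30 → W.a₆ = 52 →` used by the landed §33 rows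
`Curve446SplitCofactorLegendreLaw` / `Curve446SplitPrimeNuZeroLaw` (`GenusClassSwitchingAtTwo.lean`): one notion, two spellings (REF1 §208 R208a). -/
theorem isCurve446a1_iff (W : WeierstrassCurve ℚ) :
    IsCurve446a1 W ↔ (W.a₁ = 1 ∧ W.a₂ = 1 ∧ W.a₃ = 0 ∧ W.a₄ = -30 ∧ W.a₆ = 52) := Iff.rfl

/-- Currying bridge: a §33-style statement with the five inline binders yields its conclusion from `IsCurve446a1 W`. -/
theorem IsCurve446a1.elim {W : WeierstrassCurve ℚ} {P : Prop} (hW : IsCurve446a1 W)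
    (h : W.a₁ = 1 → W.a₂ = 1 → W.a₃ = 0 → W.a₄ = -30 → W.a₆ = 52 → P) : P :=
  h hW.1 hW.2.1 hW.2.2.1 hW.2.2.2.1 hW.2.2.2.2

/-- §35's `evalModC` and §34's `evalMod` are the same function (R208a: «§34's carriers are instances of §35's — state that, do not silently re-define»). -/
theorem evalModC_eq_evalMod : evalModC = evalMod := rfl

/-- §34's spin bit is §35's `SpinBitC` at the datum `(xnum446, xden = 4)` up to the square factor `4`: stated as the literal unfolding both sides share
(`SpinBitC` multiplies by `xden = 4 = 2²`). -/
theorem spinBitC_446_iff (p : ℕ) (a : Fin 3 → ZMod p) (i j : Fin 3) (g : ℤ[X]) :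
    SpinBitC xnum446 4 p a i j g ↔
      IsSquare (evalMod g p (a j) * (evalMod xnum446 p (a i) - evalMod xnum446 p (a j)) * (4 : ZMod p)) := by
  simp only [SpinBitC, evalModC_eq_evalMod, Nat.cast_ofNat]


/-! ## APPEND -ty g19 — DESC-35-add5 (REF1 §212): REF1's kernel lemmas K212.1–4 over the sibling statement file `GenusTrivialSpinLawWeakAtTwo.lean` (which carries -desc's three glues) (`HOME/REF1-data/b212/Probe212.lean` 49c12a08583585e9; VERBATIM).  K212.2: WD′ ⟺ «the member bit is a function of the split prime alone»; K212.3: the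
chain `SpinSetting → SpinSettingWeak`, `S′ → S⁺`, `WD′ → WD`; K212.4: `SpinSettingWeak` is literally conjuncts 1 and 4 of `SpinSetting`; K212.1: members are odd, `p ≠ 2`, `n ≠ 0`.
NOT here: K212.5/6 (the 𝔽₂ «ruling» toy behind Klagsbrun–Mazur–Rubin L.12 (iii): the totally singular planes transverse to a fixed one are EXACTLY TWO, while 8 of the 15
symplectic-Lagrangian planes are transverse — the quadratic structure is needed; they come with five toy `def`s and stay in REF1's evidence folder) and K212.7 (`SpinSettingWeak'`,
REF1's typed fallback R212c, a `def`). -/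

/-- K212.1: a genus-class-trivial member is odd and its split prime is odd (`n ≡ 1 (8)`, `p ∣ n`): the prime `2` is never the split prime,
so WD′/S′ never meet the `p = 2` junk of `ZMod p` / `jacobiSym · 2`. -/
theorem K212_1 (W : WeierstrassCurve ℚ) [W.IsGloballyMinimal] (n p : ℕ) (h : GenusTrivialTwistMember W n p) : ¬ 2 ∣ n ∧ p ≠ 2 ∧ n ≠ 0 := by
  obtain ⟨-, h8, -, hp, hpn, -, -⟩ := h
  refine ⟨?_, ?_, ?_⟩
  · rintro ⟨k, rfl⟩; push_cast at h8; omega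
  · rintro rfl; obtain ⟨k, rfl⟩ := hpn; push_cast at h8; omega
  · rintro rfl; simp at h8

/-- K212.2: WD′ says exactly that the member bit is a function of the split prime: restatement with an explicit bit-function. -/
theorem K212_2 : GenusTrivialTwistKappaWellDefinedGeneral ↔
    ∀ (W : WeierstrassCurve ℚ) [W.IsElliptic] [W.IsGloballyMinimal], selmerTwoCard W = 1 →
      ∃ κ : ℕ → Prop, ∀ n p : ℕ, GenusTrivialTwistMember W n p → (KappaBitOfMember W n p ↔ κ p) := by
  constructor
  · intro h W _ _ hS
    refine ⟨fun p => ∃ n, GenusTrivialTwistMember W n p ∧ KappaBitOfMember W n p, fun n p hn => ⟨fun hk => ⟨n, hn, hk⟩, ?_⟩⟩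
    rintro ⟨n', hn', hk'⟩
    exact (h W hS n' n p hn' hn).mp hk'
  · intro h W _ _ hS n n' p hn hn'
    obtain ⟨κ, hκ⟩ := h W hS
    exact (hκ n p hn).trans (hκ n' p hn').symm

/-- K212.3: the two settings and the three laws chain as -desc says: `SpinSetting → SpinSettingWeak`, `S′ → S⁺`, `WD′ → WD` (their glue, re-derived). -/
theorem K212_3 : (GenusTrivialTwistPureSpinLawWeak → GenusTrivialTwistPureSpinLawOddClass) ∧
    (GenusTrivialTwistKappaWellDefinedGeneral → GenusTrivialTwistKappaWellDefined) :=
  ⟨genusTrivialTwistPureSpinLawOddClass_of_weak, genusTrivialTwistKappaWellDefined_of_general⟩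

/-- K212.4: `SpinSettingWeak` genuinely drops three conjuncts of `SpinSetting`: it is literally the first and fourth conjunct. -/
theorem K212_4 (W : WeierstrassCurve ℚ) [W.IsElliptic] [W.IsGloballyMinimal] :
    SpinSetting W ↔ SpinSettingWeak W ∧ Odd (W.conductorNorm ℤ) ∧ Squarefree (W.conductorNorm ℤ) ∧ Even (W.frobeniusTrace 2) := by
  unfold SpinSetting SpinSettingWeak; tauto

/-! ## APPEND -ty g19 — DESC-35-add6 (REF1 §214): REF1's kernel lemmas K214.1–4 over the §35-add6 rows of `GenusTrivialSpinLawWeakAtTwo.lean` v2 (carriers `HasLocalRootC`,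
`DiscTwoAdicallyUnramified`, `SpinObstructingPrime`, `SpinSettingLocal`), VERBATIM from `HOME/REF1-data/b214/Probe214.lean` 4556c84de75272d4 l.80–99 (std axioms there): K214.1 a prime with
`v_ℓ(Δ) = 0` is never spin-obstructing; K214.2 the `k = 0` instance of `HasLocalRootC` is vacuous; K214.3 `SpinSettingLocal` contains the Selmer hypothesis and nothing about Tamagawa numbers
(S″ and S′ incomparable as typed); K214.4 a multiplicative prime with `v_ℓ(Δ) ≢ 2 (mod 4)` is not obstructing (table53's `I₄, I₈, I₁₂` pass vs `I₂, I₆, I₁₀` fail). -/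

/-- K214.1: a prime not dividing the (minimal) discriminant is never spin-obstructing (so good primes and `ℓ = 2` of an odd-conductor curve drop out). -/
theorem K214_1 (W : WeierstrassCurve ℚ) (c : ℤ[X]) (ℓ : ℕ) (h0 : padicValRat ℓ W.Δ = 0) : ¬ SpinObstructingPrime W c ℓ := by
  intro h; have := h.1; rw [h0] at this; exact lt_irrefl _ this

/-- K214.2: the `k = 0` instance of `HasLocalRootC` is vacuous (`ZMod 1` is a point); the content is `k ≥ 1`, i.e. a root of `c` in `ℤ_ℓ` by compactness. -/
theorem K214_2 (c : ℤ[X]) (ℓ : ℕ) : ∃ x : ZMod (ℓ ^ 0), evalModC c (ℓ ^ 0) x = 0 := by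
  haveI : Subsingleton (ZMod (ℓ ^ 0)) := by rw [pow_zero]; infer_instance
  exact ⟨0, Subsingleton.elim _ _⟩

/-- K214.3: the local setting contains the Selmer hypothesis and nothing about Tamagawa numbers (S″ and S′ are incomparable as typed: REF1 §214 census). -/
theorem K214_3 (W : WeierstrassCurve ℚ) [W.IsElliptic] [W.IsGloballyMinimal] (c : ℤ[X]) (h : SpinSettingLocal W c) : selmerTwoCard W = 1 := h.1

/-- K214.4: a multiplicative prime (`c₄ ≠ 0`, `v_ℓ(c₄) = 0`) with `v_ℓ(Δ) ≢ 2 (mod 4)` is not obstructing — the typed form of table53's rows `I₄, I₈, I₁₂` (pass) vs `I₂, I₆, I₁₀` (fail). -/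
theorem K214_4 (W : WeierstrassCurve ℚ) (c : ℤ[X]) (ℓ : ℕ) (hc : W.c₄ ≠ 0) (hv : padicValRat ℓ W.c₄ = 0) (h4 : padicValRat ℓ W.Δ % 4 ≠ 2) :
    ¬ SpinObstructingPrime W c ℓ := by
  rintro ⟨_, h | h⟩
  · exact h4 h.2.2.1
  · rcases h.1 with h0 | hpos
    · exact hc h0
    · rw [hv] at hpos; exact lt_irrefl _ hpos

end Summit.BirchSwinnertonDyer.Rank1Residual.F1Sign2.SpinLawKernel

end
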